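import Summits.AtomisticToContinuum.HydrodynamicLimit.Theses.JParityClosure
import Summits.AtomisticToContinuum.HydrodynamicLimit.Theorems.SuperextensiveClosureCostTransferInequality
import Summits.AtomisticToContinuum.HydrodynamicLimit.Theorems.JParityClosureOddContactSymmetryKineticSlabWindowRate
import HarnessLib

/-!
# The mesoscale form C⁺ of `OddContactSymmetry` from the slab bet, and S6 = the crux modulo C⁺ (line `KineticSlabSketch`)

Crux `JParityClosure.OddContactSymmetry` (stmt-AtomisticToContinuum-17722, rev 5), line `KineticSlabSketch` (card
`kinetic-slab-entropy-spending`), lead `prover-line-stmt-AtomisticToContinuum-17722-c1-0` (cycle 2).  Everything here is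
unconditional bookkeeping around the line's two registered OPEN stubs, which enter only as hypotheses spelled out verbatim:

* `mesoRate_of_slabPressure (hS1 : S1)` — **C⁺ in rate form, frame-free**: for ALL continuous local-Gibbs profiles
  `(a₀, u₀, θ₀)`, all small `σ`, every flow family, EVERY horizon `τ > 0` (no Euler solution, no `t = 0` tie, no shock
  clock), every admissible `χ, g, Ψ`, bandwidth `ϑ > 0`, level `η > 0` and rate `M > 0`: for `K ≥ K₀` and all large `N`,
  `LG_N{η < |D_{r_K}|} ≤ e^{-M(N+1)}`, where `D_{r_K} = metroOddStat … (K^{1/4}(N+1)^{-1/3}) ϑ` is the crux statistic read at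
  the kinetic mesoscale.  Proof: `windowRate_of_slabPressure` (S1 ⇒ `G_N{η < |D_{r_K}|} ≤ e^{-M'(N+1)}` under the invariant
  homogeneous Gibbs law `G_N = localGibbsLaw σ 1 0 θe`, `θe = 1 + sup|θ₀|`) and the PROVED `TransferInequality`
  (`transferInequality_proof`: `LG(S)² ≤ e^{C(N+1)} G(S)` for every set `S`) with `M' = |C| + 2M`.
* `mesoOddStat_of_slabPressure (hS1 : S1)` — the same in the crux's `≤ δ` form (C⁺ proper, frame-free, every `ϑ > 0`).
* `oddContactSymmetry_iff_scaleTransfer_of_meso (hC : C⁺_w)` — **modulo C⁺ the two-scale transfer S6 is EXACTLY the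
  crux**: `OddContactSymmetry ↔ S6`, where `C⁺_w` is the WEAKEST natural form of C⁺ (framed like the crux, and only for
  `ϑ < ϑ₀(η, δ)`), by the two union bounds `|D_r − D_{r_K}| ≤ |D_r| + |D_{r_K}|` and `|D_r| ≤ |D_r − D_{r_K}| + |D_{r_K}|` at
  `(η/2, δ/2)`.  With `mesoWeak_of_mesoOddStat` (C⁺ ⇒ C⁺_w) this certifies that S6 (`stub_scaleTransfer`) is crux-sized: it is
  at once the weakest stub closing the skeleton over C⁺ and as strong as the decl (the line lead's `promote-stub` evidence;
  equivalently, re-typing the crux as C⁺ removes exactly S6 and nothing else).  The `↔` was first kernel-checked by this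
  seat's S6 stub worker (scratch `stub_scaleTransfer_cert.lean`).

S1 = `stub_slabPressure` (equilibrium one-slab exponential moments at the kinetic mesoscale, rate divergence in `K`; the
card's bet) and S6 = `stub_scaleTransfer` ((2B): fixed `r` versus `r_K`, pre-shock) are NOT assumed anywhere: they appear
only as explicit hypotheses / sides of an `↔`.
-/

noncomputable section

open scoped BigOperators Classical InnerProductSpace ENNReal Topology
open Set MeasureTheory Filter
open Literature.Analysis.FluidPDE Literature.MathematicalPhysics.KineticTheory
open Summit.AtomisticToContinuum.HydrodynamicLimit.Theses.JParityClosure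

namespace Summit.AtomisticToContinuum.HydrodynamicLimit.Theorems.OddContactSymmetryKineticSlab

/-! ## C⁺ from the slab bet (frame-free, all horizons) -/

/-- **C⁺ in rate form from S1.**  If the slab pressure bet S1 (`stub_slabPressure`, verbatim) holds, then for every
continuous positive local-Gibbs profile triple, all small `σ`, every flow family, every horizon `τ > 0`, continuous `χ`,
continuous cutoff `g` vanishing on `[η₀, ∞)`, bounded continuous J-odd `Ψ`, `ϑ > 0`, `η > 0` and `M > 0` there is `K₀`
with: for `K ≥ K₀` and all large `N`, `localGibbsLaw σ a₀ u₀ θ₀ N (Φ N) {η < |D_{r_K}|} ≤ e^{-M(N+1)}`.  No classical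
solution, no `t = 0` tie and no shock clock are used: `windowRate_of_slabPressure` at rate `|C| + 2M` under the invariant
Gibbs law with `θe = |sup θ₀| + 1`, then `transferInequality_proof` (`LG² ≤ e^{C(N+1)} G`). [folklore] -/
theorem mesoRate_of_slabPressure :
    (∃ η₀ : ℝ, 0 < η₀ ∧ ∀ θe : ℝ, 0 < θe → ∃ σ₀ : ℝ, 0 < σ₀ ∧ ∀ σ : ℝ, 0 < σ → σ < σ₀ →
      ∀ Φ : (N : ℕ) → HardSphereFlow (Torus.geometry (Fin 3)) (hsDiameter σ N) (N + 1),
      ∀ τ : ℝ, 0 < τ → ∀ χ : ℝ × UnitAddTorus (Fin 3) → ℝ, Continuous χ →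
      ∀ g : ℝ → ℝ, Continuous g → (∀ a, η₀ ≤ a → g a = 0) →
      ∀ Ψ : V3 × V3 × V3 → ℝ, Continuous Ψ → (∃ C : ℝ, ∀ q, |Ψ q| ≤ C) →
      (∀ (n v w : V3), ‖n‖ = 1 → Ψ (-n, (reflectVel n (v, w)).1, (reflectVel n (v, w)).2) = -Ψ (n, v, w)) →
      ∀ ϑ : ℝ, 0 < ϑ → ∀ b y : ℝ, 0 < b → 0 < y →
      ∃ K₀ : ℕ, ∀ K : ℕ, K₀ ≤ K → ∃ N₀ : ℕ, ∀ N : ℕ, N₀ ≤ N →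
      ∀ s ∈ Set.Icc (0 : ℝ) τ, ∀ ℓ : ℝ,
        (K : ℝ) * ((N + 1 : ℕ) : ℝ) ^ (-(1 / 3 : ℝ)) / 2 ≤ ℓ → ℓ ≤ (K : ℝ) * ((N + 1 : ℕ) : ℝ) ^ (-(1 / 3 : ℝ)) →
      ∀ b' : ℝ, b / 2 ≤ b' → b' ≤ b →
        ∫⁻ z, ENNReal.ofReal (Real.exp (b' / K *
            |metroOddSum σ N (Φ N) (Set.Ioc 0 ℓ) (fun p => χ (p.1 + s, p.2)) g Ψ
              ((K : ℝ) ^ (1 / 4 : ℝ) * ((N + 1 : ℕ) : ℝ) ^ (-(1 / 3 : ℝ))) ϑ z|))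
          ∂(localGibbsLaw σ (fun _ => 1) (fun _ => 0) (fun _ => θe) N (Φ N))
        ≤ ENNReal.ofReal (Real.exp (b' * y * ((N : ℝ) + 1)))) →
    ∃ η₀ : ℝ, 0 < η₀ ∧ ∀ (a₀ θ₀ : T3 → ℝ) (u₀ : T3 → V3), Continuous a₀ → Continuous θ₀ → Continuous u₀ →
    (∀ x, 0 < a₀ x) → (∀ x, 0 < θ₀ x) → ∃ σ₀ : ℝ, 0 < σ₀ ∧ ∀ σ : ℝ, 0 < σ → σ < σ₀ →
    ∀ Φ : (N : ℕ) → HardSphereFlow (Torus.geometry (Fin 3)) (hsDiameter σ N) (N + 1),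
    ∀ τ : ℝ, 0 < τ → ∀ χ : ℝ × UnitAddTorus (Fin 3) → ℝ, Continuous χ →
    ∀ g : ℝ → ℝ, Continuous g → (∀ a, η₀ ≤ a → g a = 0) →
    ∀ Ψ : V3 × V3 × V3 → ℝ, Continuous Ψ → (∃ C : ℝ, ∀ q, |Ψ q| ≤ C) →
    (∀ (n v w : V3), ‖n‖ = 1 → Ψ (-n, (reflectVel n (v, w)).1, (reflectVel n (v, w)).2) = -Ψ (n, v, w)) →
    ∀ ϑ : ℝ, 0 < ϑ → ∀ η M : ℝ, 0 < η → 0 < M →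
    ∃ K₀ : ℕ, ∀ K : ℕ, K₀ ≤ K → ∃ N₀ : ℕ, ∀ N : ℕ, N₀ ≤ N →
      localGibbsLaw σ a₀ u₀ θ₀ N (Φ N)
        {z | η < |metroOddStat σ N (Φ N) τ χ g Ψ
            ((K : ℝ) ^ (1 / 4 : ℝ) * ((N + 1 : ℕ) : ℝ) ^ (-(1 / 3 : ℝ))) ϑ z|}
        ≤ ENNReal.ofReal (Real.exp (-(M * ((N : ℝ) + 1)))) := by
  intro hS1
  obtain ⟨η₀, hη₀, hW⟩ := windowRate_of_slabPressure hS1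
  refine ⟨η₀, hη₀, ?_⟩
  intro a₀ θ₀ u₀ ha hθ hu ha0 hθ0
  -- a reference temperature dominating `θ₀` (compact torus)
  obtain ⟨Cθ, hCθ⟩ :=
    (isCompact_univ (X := UnitAddTorus (Fin 3))).exists_bound_of_continuousOn hθ.continuousOn
  set θe : ℝ := |Cθ| + 1 with hθe_def
  have hθe : 0 < θe := by positivity
  have h2θe : ∀ x, θ₀ x < 2 * θe := by
    intro x
    have h1 : θ₀ x ≤ |Cθ| := by
      have := hCθ x (mem_univ x)
      rw [Real.norm_eq_abs] at this
      exact (le_abs_self _).trans (this.trans (le_abs_self _))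
    rw [hθe_def]
    linarith [abs_nonneg Cθ]
  obtain ⟨σ₁, hσ₁, hTI⟩ := transferInequality_proof a₀ θ₀ u₀ ha hθ hu ha0 hθ0 θe h2θe
  obtain ⟨σ₂, hσ₂, hWR⟩ := hW θe hθe
  refine ⟨min σ₁ σ₂, lt_min hσ₁ hσ₂, ?_⟩
  intro σ hσ hσlt Φ τ hτ χ hχ g hg hg0 Ψ hΨ hΨb hΨodd ϑ hϑ η M hη hM
  have hσ₁' : σ < σ₁ := hσlt.trans_le (min_le_left _ _)
  have hσ₂' : σ < σ₂ := hσlt.trans_le (min_le_right _ _)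
  obtain ⟨C, hC⟩ := hTI σ hσ hσ₁'
  set M' : ℝ := |C| + 2 * M with hM'_def
  have hM' : 0 < M' := by positivity
  obtain ⟨K₀, hK₀⟩ := hWR σ hσ hσ₂' Φ τ hτ χ hχ g hg hg0 Ψ hΨ hΨb hΨodd ϑ hϑ η M' hη hM'
  refine ⟨K₀, fun K hK => ?_⟩
  obtain ⟨N₀, hN₀⟩ := hK₀ K hK
  refine ⟨N₀, fun N hN => ?_⟩
  set P := localGibbsLaw σ a₀ u₀ θ₀ N (Φ N) with hP_def
  set D' : Config (N + 1) (Fin 3) T3 → ℝ := fun z => metroOddStat σ N (Φ N) τ χ g Ψ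
    ((K : ℝ) ^ (1 / 4 : ℝ) * ((N + 1 : ℕ) : ℝ) ^ (-(1 / 3 : ℝ))) ϑ z with hD'_def
  change P {z | η < |D' z|} ≤ ENNReal.ofReal (Real.exp (-(M * ((N : ℝ) + 1))))
  have h1 := hC N (Φ N) {z | η < |D' z|}
  have h2 := hN₀ N hN
  have hN0 : (0 : ℝ) ≤ (N : ℝ) + 1 := by positivity
  have hCM : (C - M') * ((N : ℝ) + 1) ≤ -(2 * M) * ((N : ℝ) + 1) := by
    have : C - M' ≤ -(2 * M) := by rw [hM'_def]; linarith [le_abs_self C]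
    exact mul_le_mul_of_nonneg_right this hN0
  have h3 : P {z | η < |D' z|} ^ 2 ≤ ENNReal.ofReal (Real.exp (-(M * ((N : ℝ) + 1)))) ^ 2 := by
    calc P {z | η < |D' z|} ^ 2
        ≤ ENNReal.ofReal (Real.exp (C * (N + 1))) *
            ENNReal.ofReal (Real.exp (-(M' * ((N : ℝ) + 1)))) := h1.trans (by gcongr)
      _ = ENNReal.ofReal (Real.exp ((C - M') * ((N : ℝ) + 1))) := by
          rw [← ENNReal.ofReal_mul (Real.exp_pos _).le, ← Real.exp_add]
          congr 1; congr 1; ring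
      _ ≤ ENNReal.ofReal (Real.exp (-(2 * M) * ((N : ℝ) + 1))) :=
          ENNReal.ofReal_le_ofReal (Real.exp_le_exp.2 hCM)
      _ = ENNReal.ofReal (Real.exp (-(M * ((N : ℝ) + 1)))) ^ 2 := by
          rw [← ENNReal.ofReal_pow (Real.exp_pos _).le, ← Real.exp_nat_mul]
          congr 1; congr 1; push_cast; ring
  exact (ENNReal.pow_le_pow_left_iff two_ne_zero).1 h3

/-- **C⁺ proper from S1** (the crux's `≤ δ` form, frame-free, every horizon and every bandwidth `ϑ > 0`): for `K ≥ K₀`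
and all large `N`, `localGibbsLaw σ a₀ u₀ θ₀ N (Φ N) {η < |D_{r_K}|} ≤ δ`.  From `mesoRate_of_slabPressure` at `M = 1` and
`e^{-(N+1)} ≤ δ` eventually.  This is the statement the planner is advised to re-type the crux into (reading scale
`r ↦ K^{1/4}(N+1)^{-1/3}`, `∃ K₀ ∀ K ≥ K₀` in place of `∃ r₀ ∀ r < r₀`). [folklore] -/
theorem mesoOddStat_of_slabPressure :
    (∃ η₀ : ℝ, 0 < η₀ ∧ ∀ θe : ℝ, 0 < θe → ∃ σ₀ : ℝ, 0 < σ₀ ∧ ∀ σ : ℝ, 0 < σ → σ < σ₀ →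
      ∀ Φ : (N : ℕ) → HardSphereFlow (Torus.geometry (Fin 3)) (hsDiameter σ N) (N + 1),
      ∀ τ : ℝ, 0 < τ → ∀ χ : ℝ × UnitAddTorus (Fin 3) → ℝ, Continuous χ →
      ∀ g : ℝ → ℝ, Continuous g → (∀ a, η₀ ≤ a → g a = 0) →
      ∀ Ψ : V3 × V3 × V3 → ℝ, Continuous Ψ → (∃ C : ℝ, ∀ q, |Ψ q| ≤ C) →
      (∀ (n v w : V3), ‖n‖ = 1 → Ψ (-n, (reflectVel n (v, w)).1, (reflectVel n (v, w)).2) = -Ψ (n, v, w)) →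
      ∀ ϑ : ℝ, 0 < ϑ → ∀ b y : ℝ, 0 < b → 0 < y →
      ∃ K₀ : ℕ, ∀ K : ℕ, K₀ ≤ K → ∃ N₀ : ℕ, ∀ N : ℕ, N₀ ≤ N →
      ∀ s ∈ Set.Icc (0 : ℝ) τ, ∀ ℓ : ℝ,
        (K : ℝ) * ((N + 1 : ℕ) : ℝ) ^ (-(1 / 3 : ℝ)) / 2 ≤ ℓ → ℓ ≤ (K : ℝ) * ((N + 1 : ℕ) : ℝ) ^ (-(1 / 3 : ℝ)) →
      ∀ b' : ℝ, b / 2 ≤ b' → b' ≤ b →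
        ∫⁻ z, ENNReal.ofReal (Real.exp (b' / K *
            |metroOddSum σ N (Φ N) (Set.Ioc 0 ℓ) (fun p => χ (p.1 + s, p.2)) g Ψ
              ((K : ℝ) ^ (1 / 4 : ℝ) * ((N + 1 : ℕ) : ℝ) ^ (-(1 / 3 : ℝ))) ϑ z|))
          ∂(localGibbsLaw σ (fun _ => 1) (fun _ => 0) (fun _ => θe) N (Φ N))
        ≤ ENNReal.ofReal (Real.exp (b' * y * ((N : ℝ) + 1)))) →
    ∃ η₀ : ℝ, 0 < η₀ ∧ ∀ (a₀ θ₀ : T3 → ℝ) (u₀ : T3 → V3), Continuous a₀ → Continuous θ₀ → Continuous u₀ →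
    (∀ x, 0 < a₀ x) → (∀ x, 0 < θ₀ x) → ∃ σ₀ : ℝ, 0 < σ₀ ∧ ∀ σ : ℝ, 0 < σ → σ < σ₀ →
    ∀ Φ : (N : ℕ) → HardSphereFlow (Torus.geometry (Fin 3)) (hsDiameter σ N) (N + 1),
    ∀ τ : ℝ, 0 < τ → ∀ χ : ℝ × UnitAddTorus (Fin 3) → ℝ, Continuous χ →
    ∀ g : ℝ → ℝ, Continuous g → (∀ a, η₀ ≤ a → g a = 0) →
    ∀ Ψ : V3 × V3 × V3 → ℝ, Continuous Ψ → (∃ C : ℝ, ∀ q, |Ψ q| ≤ C) →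
    (∀ (n v w : V3), ‖n‖ = 1 → Ψ (-n, (reflectVel n (v, w)).1, (reflectVel n (v, w)).2) = -Ψ (n, v, w)) →
    ∀ ϑ : ℝ, 0 < ϑ → ∀ η δ : ℝ, 0 < η → 0 < δ →
    ∃ K₀ : ℕ, ∀ K : ℕ, K₀ ≤ K → ∃ N₀ : ℕ, ∀ N : ℕ, N₀ ≤ N →
      localGibbsLaw σ a₀ u₀ θ₀ N (Φ N)
        {z | η < |metroOddStat σ N (Φ N) τ χ g Ψ
            ((K : ℝ) ^ (1 / 4 : ℝ) * ((N + 1 : ℕ) : ℝ) ^ (-(1 / 3 : ℝ))) ϑ z|}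
        ≤ ENNReal.ofReal δ := by
  intro hS1
  obtain ⟨η₀, hη₀, hR⟩ := mesoRate_of_slabPressure hS1
  refine ⟨η₀, hη₀, ?_⟩
  intro a₀ θ₀ u₀ ha hθ hu ha0 hθ0
  obtain ⟨σ₀, hσ₀, hR'⟩ := hR a₀ θ₀ u₀ ha hθ hu ha0 hθ0
  refine ⟨σ₀, hσ₀, ?_⟩
  intro σ hσ hσlt Φ τ hτ χ hχ g hg hg0 Ψ hΨ hΨb hΨodd ϑ hϑ η δ hη hδ
  obtain ⟨K₀, hK₀⟩ := hR' σ hσ hσlt Φ τ hτ χ hχ g hg hg0 Ψ hΨ hΨb hΨodd ϑ hϑ η 1 hη one_pos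
  refine ⟨K₀, fun K hK => ?_⟩
  obtain ⟨N₀, hN₀⟩ := hK₀ K hK
  -- `exp (-(N+1)) ≤ δ` eventually
  obtain ⟨N₁, hN₁⟩ : ∃ N₁ : ℕ, ∀ N : ℕ, N₁ ≤ N → Real.exp (-(1 * ((N : ℝ) + 1))) ≤ δ := by
    have ht : Tendsto (fun N : ℕ => Real.exp (-(1 * ((N : ℝ) + 1)))) atTop (𝓝 0) := by
      refine Real.tendsto_exp_atBot.comp ?_
      have h1 : Tendsto (fun N : ℕ => (N : ℝ) + 1) atTop atTop :=
        tendsto_natCast_atTop_atTop.atTop_add tendsto_const_nhds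
      have h2 : Tendsto (fun N : ℕ => -((N : ℝ) + 1)) atTop atBot := tendsto_neg_atTop_atBot.comp h1
      exact h2.congr fun N => by ring
    obtain ⟨N₁, hN₁⟩ := eventually_atTop.1 (ht.eventually (Iic_mem_nhds hδ))
    exact ⟨N₁, fun N hN => hN₁ N hN⟩
  refine ⟨max N₀ N₁, fun N hN => ?_⟩
  exact (hN₀ N ((le_max_left _ _).trans hN)).trans
    (ENNReal.ofReal_le_ofReal (hN₁ N ((le_max_right _ _).trans hN)))

/-! ## S6 is the crux modulo C⁺ -/

/-- **C⁺ (frame-free, every `ϑ`) implies its weakest framed form C⁺_w** (framed like the crux: classical solution,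
`t = 0` tie, `τ < T`; and only for `ϑ < ϑ₀(η, δ)`): the frame hypotheses are ignored and `ϑ₀ := 1`. [folklore] -/
theorem mesoWeak_of_mesoOddStat :
    (∃ η₀ : ℝ, 0 < η₀ ∧ ∀ (a₀ θ₀ : T3 → ℝ) (u₀ : T3 → V3), Continuous a₀ → Continuous θ₀ → Continuous u₀ →
      (∀ x, 0 < a₀ x) → (∀ x, 0 < θ₀ x) → ∃ σ₀ : ℝ, 0 < σ₀ ∧ ∀ σ : ℝ, 0 < σ → σ < σ₀ →
      ∀ Φ : (N : ℕ) → HardSphereFlow (Torus.geometry (Fin 3)) (hsDiameter σ N) (N + 1),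
      ∀ τ : ℝ, 0 < τ → ∀ χ : ℝ × UnitAddTorus (Fin 3) → ℝ, Continuous χ →
      ∀ g : ℝ → ℝ, Continuous g → (∀ a, η₀ ≤ a → g a = 0) →
      ∀ Ψ : V3 × V3 × V3 → ℝ, Continuous Ψ → (∃ C : ℝ, ∀ q, |Ψ q| ≤ C) →
      (∀ (n v w : V3), ‖n‖ = 1 → Ψ (-n, (reflectVel n (v, w)).1, (reflectVel n (v, w)).2) = -Ψ (n, v, w)) →
      ∀ ϑ : ℝ, 0 < ϑ → ∀ η δ : ℝ, 0 < η → 0 < δ →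
      ∃ K₀ : ℕ, ∀ K : ℕ, K₀ ≤ K → ∃ N₀ : ℕ, ∀ N : ℕ, N₀ ≤ N →
        localGibbsLaw σ a₀ u₀ θ₀ N (Φ N)
          {z | η < |metroOddStat σ N (Φ N) τ χ g Ψ
              ((K : ℝ) ^ (1 / 4 : ℝ) * ((N + 1 : ℕ) : ℝ) ^ (-(1 / 3 : ℝ))) ϑ z|}
          ≤ ENNReal.ofReal δ) →
    ∃ η₀ : ℝ, 0 < η₀ ∧ ∀ (a₀ θ₀ : T3 → ℝ) (u₀ : T3 → V3), Continuous a₀ → Continuous θ₀ → Continuous u₀ →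
    (∀ x, 0 < a₀ x) → (∀ x, 0 < θ₀ x) → ∃ σ₀ : ℝ, 0 < σ₀ ∧ ∀ σ : ℝ, 0 < σ → σ < σ₀ →
    ∀ (T : ℝ) (ρ θ : ℝ → T3 → ℝ) (u : ℝ → T3 → V3), IsHardSphereEulerSolution σ T ρ u θ →
    ∀ Φ : (N : ℕ) → HardSphereFlow (Torus.geometry (Fin 3)) (hsDiameter σ N) (N + 1),
    TendstoHydroFieldsAt (fun N => localGibbsLaw σ a₀ u₀ θ₀ N (Φ N)) Φ ρ u θ 0 →
    ∀ τ : ℝ, 0 < τ → τ < T → ∀ χ : ℝ × UnitAddTorus (Fin 3) → ℝ, Continuous χ →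
    ∀ g : ℝ → ℝ, Continuous g → (∀ a, η₀ ≤ a → g a = 0) →
    ∀ Ψ : V3 × V3 × V3 → ℝ, Continuous Ψ → (∃ C : ℝ, ∀ q, |Ψ q| ≤ C) →
    (∀ (n v w : V3), ‖n‖ = 1 → Ψ (-n, (reflectVel n (v, w)).1, (reflectVel n (v, w)).2) = -Ψ (n, v, w)) →
    ∀ η δ : ℝ, 0 < η → 0 < δ → ∃ ϑ₀ : ℝ, 0 < ϑ₀ ∧ ∀ ϑ : ℝ, 0 < ϑ → ϑ < ϑ₀ →
    ∃ K₀ : ℕ, ∀ K : ℕ, K₀ ≤ K → ∃ N₀ : ℕ, ∀ N : ℕ, N₀ ≤ N →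
      localGibbsLaw σ a₀ u₀ θ₀ N (Φ N)
        {z | η < |metroOddStat σ N (Φ N) τ χ g Ψ
            ((K : ℝ) ^ (1 / 4 : ℝ) * ((N + 1 : ℕ) : ℝ) ^ (-(1 / 3 : ℝ))) ϑ z|}
        ≤ ENNReal.ofReal δ := by
  intro hC
  obtain ⟨η₀, hη₀, H⟩ := hC
  refine ⟨η₀, hη₀, fun a₀ θ₀ u₀ ha hθ hu ha0 hθ0 => ?_⟩
  obtain ⟨σ₀, hσ₀, Hσ⟩ := H a₀ θ₀ u₀ ha hθ hu ha0 hθ0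
  refine ⟨σ₀, hσ₀, ?_⟩
  intro σ hσ hσlt T ρ θ u _ Φ _ τ hτ _ χ hχ g hg hg0 Ψ hΨ hΨb hΨodd η δ hη hδ
  exact ⟨1, one_pos, fun ϑ hϑ _ => Hσ σ hσ hσlt Φ τ hτ χ hχ g hg hg0 Ψ hΨ hΨb hΨodd ϑ hϑ η δ hη hδ⟩

/-- Elementary union bound used twice: `{η < |A|} ⊆ {η/2 < |B|} ∪ {η/2 < |A − B|}` (given as `hsub`) and the two halves
have probability at most `δ/2` each. [folklore] -/
theorem measure_setOf_lt_abs_le_of_halves {Ω : Type*} [MeasurableSpace Ω] (P : Measure Ω) (A B : Ω → ℝ)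
    {η δ : ℝ} (hδ : 0 < δ)
    (hsub : {z | η < |A z|} ⊆ {z | η / 2 < |B z|} ∪ {z | η / 2 < |A z - B z|})
    (hB : P {z | η / 2 < |B z|} ≤ ENNReal.ofReal (δ / 2))
    (hAB : P {z | η / 2 < |A z - B z|} ≤ ENNReal.ofReal (δ / 2)) :
    P {z | η < |A z|} ≤ ENNReal.ofReal δ := by
  have hδ2 : 0 ≤ δ / 2 := by positivity
  calc P {z | η < |A z|}
      ≤ P ({z | η / 2 < |B z|} ∪ {z | η / 2 < |A z - B z|}) := measure_mono hsub
    _ ≤ P {z | η / 2 < |B z|} + P {z | η / 2 < |A z - B z|} := measure_union_le _ _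
    _ ≤ ENNReal.ofReal (δ / 2) + ENNReal.ofReal (δ / 2) := add_le_add hB hAB
    _ = ENNReal.ofReal δ := by rw [← ENNReal.ofReal_add hδ2 hδ2, add_halves]

/-- **Modulo C⁺_w, the two-scale transfer S6 is EXACTLY the crux**: assuming the weakest framed mesoscale statement
C⁺_w (the crux statistic read at `r_K = K^{1/4}(N+1)^{-1/3}` tends to `0` in local-Gibbs probability pre-shock, for
`ϑ < ϑ₀(η,δ)`, `K ≥ K₀`, `N → ∞`), the registered stub S6 `stub_scaleTransfer` (right-hand side, verbatim) is equivalent to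
`OddContactSymmetry`.  `→`: `|D_r − D_{r_K}| ≤ |D_r| + |D_{r_K}|` with the crux at `(η/2, δ/2)` and C⁺_w at `(η/2, δ/2)`,
`r₀ := min r₀ ϑ₀`; `←`: `|D_r| ≤ |D_r − D_{r_K}| + |D_{r_K}|` at one common `K = max K₀ K₀'`.  Hence S6 is crux-sized (it is
the weakest stub closing the skeleton over C⁺ and as strong as the decl): the lead's `promote-stub` certificate; re-typing
the crux as C⁺ removes exactly S6. [folklore] -/
theorem oddContactSymmetry_iff_scaleTransfer_of_meso :
    (∃ η₀ : ℝ, 0 < η₀ ∧ ∀ (a₀ θ₀ : T3 → ℝ) (u₀ : T3 → V3), Continuous a₀ → Continuous θ₀ → Continuous u₀ →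
      (∀ x, 0 < a₀ x) → (∀ x, 0 < θ₀ x) → ∃ σ₀ : ℝ, 0 < σ₀ ∧ ∀ σ : ℝ, 0 < σ → σ < σ₀ →
      ∀ (T : ℝ) (ρ θ : ℝ → T3 → ℝ) (u : ℝ → T3 → V3), IsHardSphereEulerSolution σ T ρ u θ →
      ∀ Φ : (N : ℕ) → HardSphereFlow (Torus.geometry (Fin 3)) (hsDiameter σ N) (N + 1),
      TendstoHydroFieldsAt (fun N => localGibbsLaw σ a₀ u₀ θ₀ N (Φ N)) Φ ρ u θ 0 →
      ∀ τ : ℝ, 0 < τ → τ < T → ∀ χ : ℝ × UnitAddTorus (Fin 3) → ℝ, Continuous χ →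
      ∀ g : ℝ → ℝ, Continuous g → (∀ a, η₀ ≤ a → g a = 0) →
      ∀ Ψ : V3 × V3 × V3 → ℝ, Continuous Ψ → (∃ C : ℝ, ∀ q, |Ψ q| ≤ C) →
      (∀ (n v w : V3), ‖n‖ = 1 → Ψ (-n, (reflectVel n (v, w)).1, (reflectVel n (v, w)).2) = -Ψ (n, v, w)) →
      ∀ η δ : ℝ, 0 < η → 0 < δ → ∃ ϑ₀ : ℝ, 0 < ϑ₀ ∧ ∀ ϑ : ℝ, 0 < ϑ → ϑ < ϑ₀ →
      ∃ K₀ : ℕ, ∀ K : ℕ, K₀ ≤ K → ∃ N₀ : ℕ, ∀ N : ℕ, N₀ ≤ N →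
        localGibbsLaw σ a₀ u₀ θ₀ N (Φ N)
          {z | η < |metroOddStat σ N (Φ N) τ χ g Ψ
              ((K : ℝ) ^ (1 / 4 : ℝ) * ((N + 1 : ℕ) : ℝ) ^ (-(1 / 3 : ℝ))) ϑ z|}
          ≤ ENNReal.ofReal δ) →
    (OddContactSymmetry ↔
    (∃ η₀ : ℝ, 0 < η₀ ∧ ∀ (a₀ θ₀ : T3 → ℝ) (u₀ : T3 → V3), Continuous a₀ → Continuous θ₀ → Continuous u₀ →
    (∀ x, 0 < a₀ x) → (∀ x, 0 < θ₀ x) → ∃ σ₀ : ℝ, 0 < σ₀ ∧ ∀ σ : ℝ, 0 < σ → σ < σ₀ →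
    ∀ (T : ℝ) (ρ θ : ℝ → T3 → ℝ) (u : ℝ → T3 → V3), IsHardSphereEulerSolution σ T ρ u θ →
    ∀ Φ : (N : ℕ) → HardSphereFlow (Torus.geometry (Fin 3)) (hsDiameter σ N) (N + 1),
    TendstoHydroFieldsAt (fun N => localGibbsLaw σ a₀ u₀ θ₀ N (Φ N)) Φ ρ u θ 0 →
    ∀ τ : ℝ, 0 < τ → τ < T → ∀ χ : ℝ × UnitAddTorus (Fin 3) → ℝ, Continuous χ →
    ∀ g : ℝ → ℝ, Continuous g → (∀ a, η₀ ≤ a → g a = 0) →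
    ∀ Ψ : V3 × V3 × V3 → ℝ, Continuous Ψ → (∃ C : ℝ, ∀ q, |Ψ q| ≤ C) →
    (∀ (n v w : V3), ‖n‖ = 1 → Ψ (-n, (reflectVel n (v, w)).1, (reflectVel n (v, w)).2) = -Ψ (n, v, w)) →
    ∀ η δ : ℝ, 0 < η → 0 < δ → ∃ r₀ : ℝ, 0 < r₀ ∧ ∀ r ϑ : ℝ, 0 < r → r < r₀ → 0 < ϑ → ϑ < r₀ →
    ∃ K₀ : ℕ, ∀ K : ℕ, K₀ ≤ K → ∃ N₀ : ℕ, ∀ N : ℕ, N₀ ≤ N →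
      localGibbsLaw σ a₀ u₀ θ₀ N (Φ N)
        {z | η < |metroOddStat σ N (Φ N) τ χ g Ψ r ϑ z -
            metroOddStat σ N (Φ N) τ χ g Ψ
              ((K : ℝ) ^ (1 / 4 : ℝ) * ((N + 1 : ℕ) : ℝ) ^ (-(1 / 3 : ℝ))) ϑ z|}
        ≤ ENNReal.ofReal δ)) := by
  intro hC
  obtain ⟨η₂, hη₂, h2⟩ := hC
  constructor
  · -- crux ∧ C⁺_w ⟹ S6
    intro h
    obtain ⟨η₁, hη₁, h1⟩ := h
    refine ⟨min η₁ η₂, lt_min hη₁ hη₂, ?_⟩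
    intro a₀ θ₀ u₀ ha hθ hu ha0 hθ0
    obtain ⟨σ₁, hσ₁, h1'⟩ := h1 a₀ θ₀ u₀ ha hθ hu ha0 hθ0
    obtain ⟨σ₂, hσ₂, h2'⟩ := h2 a₀ θ₀ u₀ ha hθ hu ha0 hθ0
    refine ⟨min σ₁ σ₂, lt_min hσ₁ hσ₂, ?_⟩
    intro σ hσ hσlt T ρ θ u hsol Φ hLLN τ hτ hτT χ hχ g hg hg0 Ψ hΨ hΨb hΨodd η δ hη hδ
    have hg₁ : ∀ a, η₁ ≤ a → g a = 0 := fun a ha' => hg0 a ((min_le_left _ _).trans ha')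
    have hg₂ : ∀ a, η₂ ≤ a → g a = 0 := fun a ha' => hg0 a ((min_le_right _ _).trans ha')
    have hη2 : 0 < η / 2 := by positivity
    have hδ2 : 0 < δ / 2 := by positivity
    obtain ⟨r₁, hr₁, hr⟩ := h1' σ hσ (hσlt.trans_le (min_le_left _ _)) T ρ θ u hsol Φ hLLN τ hτ hτT χ hχ
      g hg hg₁ Ψ hΨ hΨb hΨodd (η / 2) (δ / 2) hη2 hδ2
    obtain ⟨ϑ₀, hϑ₀, hm⟩ := h2' σ hσ (hσlt.trans_le (min_le_right _ _)) T ρ θ u hsol Φ hLLN τ hτ hτT χ hχ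
      g hg hg₂ Ψ hΨ hΨb hΨodd (η / 2) (δ / 2) hη2 hδ2
    refine ⟨min r₁ ϑ₀, lt_min hr₁ hϑ₀, ?_⟩
    intro r ϑ hr0 hrr hϑ0 hϑr
    obtain ⟨N₁, hN₁⟩ := hr r ϑ hr0 (hrr.trans_le (min_le_left _ _)) hϑ0
      (hϑr.trans_le (min_le_left _ _))
    obtain ⟨K₀, hK₀⟩ := hm ϑ hϑ0 (hϑr.trans_le (min_le_right _ _))
    refine ⟨K₀, fun K hK => ?_⟩
    obtain ⟨N₂, hN₂⟩ := hK₀ K hK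
    refine ⟨max N₁ N₂, fun N hN => ?_⟩
    have hA := hN₁ N ((le_max_left _ _).trans hN)
    have hB := hN₂ N ((le_max_right _ _).trans hN)
    set P := localGibbsLaw σ a₀ u₀ θ₀ N (Φ N) with hP
    set D : Config (N + 1) (Fin 3) T3 → ℝ := fun z => metroOddStat σ N (Φ N) τ χ g Ψ r ϑ z with hD
    set D' : Config (N + 1) (Fin 3) T3 → ℝ := fun z => metroOddStat σ N (Φ N) τ χ g Ψ
      ((K : ℝ) ^ (1 / 4 : ℝ) * ((N + 1 : ℕ) : ℝ) ^ (-(1 / 3 : ℝ))) ϑ z with hD'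
    change P {z | η / 2 < |D z|} ≤ ENNReal.ofReal (δ / 2) at hA
    change P {z | η / 2 < |D' z|} ≤ ENNReal.ofReal (δ / 2) at hB
    change P {z | η < |D z - D' z|} ≤ ENNReal.ofReal δ
    have hsub : {z | η < |D z - D' z|} ⊆ {z | η / 2 < |D z|} ∪ {z | η / 2 < |D' z|} := by
      intro z hz
      simp only [mem_setOf_eq, mem_union] at hz ⊢
      by_contra hcon
      push Not at hcon
      have := abs_sub (D z) (D' z)
      linarith [hcon.1, hcon.2]
    calc P {z | η < |D z - D' z|} ≤ P ({z | η / 2 < |D z|} ∪ {z | η / 2 < |D' z|}) := measure_mono hsub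
      _ ≤ P {z | η / 2 < |D z|} + P {z | η / 2 < |D' z|} := measure_union_le _ _
      _ ≤ ENNReal.ofReal (δ / 2) + ENNReal.ofReal (δ / 2) := add_le_add hA hB
      _ = ENNReal.ofReal δ := by rw [← ENNReal.ofReal_add hδ2.le hδ2.le, add_halves]
  · -- S6 ∧ C⁺_w ⟹ crux
    intro hS
    obtain ⟨η₁, hη₁, h1⟩ := hS
    refine ⟨min η₁ η₂, lt_min hη₁ hη₂, ?_⟩
    intro a₀ θ₀ u₀ ha hθ hu ha0 hθ0
    obtain ⟨σ₁, hσ₁, h1'⟩ := h1 a₀ θ₀ u₀ ha hθ hu ha0 hθ0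
    obtain ⟨σ₂, hσ₂, h2'⟩ := h2 a₀ θ₀ u₀ ha hθ hu ha0 hθ0
    refine ⟨min σ₁ σ₂, lt_min hσ₁ hσ₂, ?_⟩
    intro σ hσ hσlt T ρ θ u hsol Φ hLLN τ hτ hτT χ hχ g hg hg0 Ψ hΨ hΨb hΨodd η δ hη hδ
    have hg₁ : ∀ a, η₁ ≤ a → g a = 0 := fun a ha' => hg0 a ((min_le_left _ _).trans ha')
    have hg₂ : ∀ a, η₂ ≤ a → g a = 0 := fun a ha' => hg0 a ((min_le_right _ _).trans ha')
    have hη2 : 0 < η / 2 := by positivity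
    have hδ2 : 0 < δ / 2 := by positivity
    obtain ⟨r₁, hr₁, hr⟩ := h1' σ hσ (hσlt.trans_le (min_le_left _ _)) T ρ θ u hsol Φ hLLN τ hτ hτT χ hχ
      g hg hg₁ Ψ hΨ hΨb hΨodd (η / 2) (δ / 2) hη2 hδ2
    obtain ⟨ϑ₀, hϑ₀, hm⟩ := h2' σ hσ (hσlt.trans_le (min_le_right _ _)) T ρ θ u hsol Φ hLLN τ hτ hτT χ hχ
      g hg hg₂ Ψ hΨ hΨb hΨodd (η / 2) (δ / 2) hη2 hδ2
    refine ⟨min r₁ ϑ₀, lt_min hr₁ hϑ₀, ?_⟩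
    intro r ϑ hr0 hrr hϑ0 hϑr
    obtain ⟨K₁, hK₁⟩ := hr r ϑ hr0 (hrr.trans_le (min_le_left _ _)) hϑ0
      (hϑr.trans_le (min_le_left _ _))
    obtain ⟨K₂, hK₂⟩ := hm ϑ hϑ0 (hϑr.trans_le (min_le_right _ _))
    obtain ⟨N₁, hN₁⟩ := hK₁ (max K₁ K₂) (le_max_left _ _)
    obtain ⟨N₂, hN₂⟩ := hK₂ (max K₁ K₂) (le_max_right _ _)
    refine ⟨max N₁ N₂, fun N hN => ?_⟩
    have hA := hN₁ N ((le_max_left _ _).trans hN)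
    have hB := hN₂ N ((le_max_right _ _).trans hN)
    set K : ℕ := max K₁ K₂ with hK
    set P := localGibbsLaw σ a₀ u₀ θ₀ N (Φ N) with hP
    set D : Config (N + 1) (Fin 3) T3 → ℝ := fun z => metroOddStat σ N (Φ N) τ χ g Ψ r ϑ z with hD
    set D' : Config (N + 1) (Fin 3) T3 → ℝ := fun z => metroOddStat σ N (Φ N) τ χ g Ψ
      ((K : ℝ) ^ (1 / 4 : ℝ) * ((N + 1 : ℕ) : ℝ) ^ (-(1 / 3 : ℝ))) ϑ z with hD'
    change P {z | η / 2 < |D z - D' z|} ≤ ENNReal.ofReal (δ / 2) at hA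
    change P {z | η / 2 < |D' z|} ≤ ENNReal.ofReal (δ / 2) at hB
    change P {z | η < |D z|} ≤ ENNReal.ofReal δ
    refine measure_setOf_lt_abs_le_of_halves P D D' hδ ?_ hB hA
    intro z hz
    simp only [mem_setOf_eq, mem_union] at hz ⊢
    by_contra hcon
    push Not at hcon
    have := abs_sub_abs_le_abs_sub (D z) (D' z)
    linarith [hcon.1, hcon.2]

end Summit.AtomisticToContinuum.HydrodynamicLimit.Theorems.OddContactSymmetryKineticSlab

end
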